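import Literature.Combinatorics.SimpleGraph.HamiltonianDiamondChain
import Literature.Combinatorics.SimpleGraph.HamiltonianPathEnumeration
import Mathlib.Data.List.Range
import Mathlib.Data.List.GetD
import Mathlib.Data.Fintype.Pi
import HarnessLib

/-!
# The rod chain: a skeleton of two-state ladders whose Hamiltonian paths are the bit vectors

A second skeleton for the gadget substitutions of the `#3SAT → #HamPath` construction (the first is
the diamond chain of `HamiltonianDiamondChain.lean`), designed so that signals can CROSS it: a chain
of `N` **rods**, rod `k` occupying the block `22k, …, 22k + 21` of `ℕ`:

* `22k` the entry bead `e`, `22k+1` the top junction `Jt`, `22k+2+i` the left rail `aᵢ`,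
  `22k+8+i` the right rail `bᵢ`, `22k+14+i` the rung midpoint `mᵢ` (`i < 6`), `22k+20` the bottom
  junction `Jb`, `22k+21` the exit bead `c`;
* edges `e–Jt`, `Jt–a₀`, `Jt–b₀`, the rails `aᵢ–aᵢ₊₁`, `bᵢ–bᵢ₊₁`, the subdivided rungs `aᵢ–mᵢ–bᵢ`,
  `a₅–Jb`, `b₅–Jb`, `Jb–c`, and `c` to the entry bead of the next rod.

A Hamiltonian path from `s = 0` to `t = 22N - 1` traverses the rods in order and each rod `k` in one
of exactly two ways (the rung midpoints force every rung, Garey–Johnson–Tarjan's degree-two forcing):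
the zigzag `zig true` entering the left rail first (`σ k = true`) or `zig false` entering the right
rail first. **The Hamiltonian `s`–`t` paths are exactly the `2^N` paths `pathOf N σ`**
(`RodChain.isHamPathOn_iff`), the constrained counts `hamCountRF` of the skeleton are numbers of bit
vectors (`RodChain.hamCountRF_eq_card`), and which edges of rod `k` a path uses is read off `σ k`
(`RodChain.uses_pathOf_iff`: a decidable table `RodChain.usesB`). Every rail edge is used by exactly
one of the two traversals, so rail edges on BOTH sides of a rod are "signature" edges — this is what
lets a signal pass a rod through a pair of slots of equal type without constraining it
(`FormulaRodLayout.lean`).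

The per-rod analysis is a kernel computation: the Hamiltonian paths of one block from `Jt` to `c` are
enumerated by the verified enumerator of `HamiltonianPathEnumeration.lean` (`RodChain.hamPathsList_block`)
and transported to every block of the chain; the induction on `N` cuts at the entry beads (degree two)
with `IsHamPathOn.split` of `HamiltonianDiamondChain.lean`.

## References

* M. R. Garey, D. S. Johnson, R. E. Tarjan, SIAM J. Comput. 5 (1976) 704–714, §2 (degree-two forcing,
  ladders of the XOR-gadget).
* M. Liśkiewicz, M. Ogihara, S. Toda, TCS 304 (2003) 129–156, §3 (two-node cycles as two-state devices).
-/

namespace Literature.Combinatorics.SimpleGraph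

namespace RodChain

/-! ### The rod template (one block, offsets `0, …, 21`) -/

/-- The directed edge table of one rod on the offsets `0, …, 21`: `e=0`, `Jt=1`, `aᵢ=2+i`, `bᵢ=8+i`,
`mᵢ=14+i`, `Jb=20`, `c=21`. [folklore] -/
def tmplRelB (r s : ℕ) : Bool :=
  (r == 0 && s == 1) || (r == 1 && (s == 2 || s == 8)) ||
    (2 ≤ r && r < 7 && s == r + 1) || (8 ≤ r && r < 13 && s == r + 1) ||
    (2 ≤ r && r < 8 && s == r + 12) || (14 ≤ r && r < 20 && s + 6 == r) ||
    (r == 7 && s == 20) || (r == 13 && s == 20) || (r == 20 && s == 21)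

/-- The symmetrised template adjacency, as a Boolean relation. [folklore] -/
def tmplAdjB (r s : ℕ) : Bool :=
  r != s && (tmplRelB r s || tmplRelB s r)

/-- **The two traversals of a rod**, as lists of offsets: `zig true` enters the left rail first
(`e Jt a₀ m₀ b₀ b₁ m₁ a₁ a₂ …`), `zig false` the right rail first. [folklore] -/
def zig (b : Bool) : List ℕ :=
  if b then [0, 1, 2, 14, 8, 9, 15, 3, 4, 16, 10, 11, 17, 5, 6, 18, 12, 13, 19, 7, 20, 21]
  else [0, 1, 8, 14, 2, 3, 15, 9, 10, 16, 4, 5, 17, 11, 12, 18, 6, 7, 19, 13, 20, 21]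

/-- The position-to-offset table of a traversal (identity beyond the block). [folklore] -/
def tmplPos (b : Bool) (i : ℕ) : ℕ :=
  (zig b).getD i i

/-- The offset-to-position table of a traversal (identity beyond the block). [folklore] -/
def tmplInv (b : Bool) (r : ℕ) : ℕ :=
  if r < 22 then (zig b).idxOf r else r

/-- **Which template edges a traversal uses**: `(r, s)` consecutive (in either order) in `zig b`.
[folklore] -/
def usesB (b : Bool) (r s : ℕ) : Bool :=
  (List.range 21).any fun i => (tmplPos b i == r && tmplPos b (i + 1) == s) ||
    (tmplPos b i == s && tmplPos b (i + 1) == r)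

/-- The traversal lists, by `decide`. [folklore] -/
theorem zig_true : zig true = [0, 1, 2, 14, 8, 9, 15, 3, 4, 16, 10, 11, 17, 5, 6, 18, 12, 13, 19, 7, 20, 21] := rfl

/-- The traversal lists, by `decide`. [folklore] -/
theorem zig_false : zig false = [0, 1, 8, 14, 2, 3, 15, 9, 10, 16, 4, 5, 17, 11, 12, 18, 6, 7, 19, 13, 20, 21] := rfl

/-- The traversals have `22` entries. [folklore] -/
theorem length_zig (b : Bool) : (zig b).length = 22 := by cases b <;> rfl

/-- The table is the identity beyond the block. [folklore] -/
theorem tmplPos_of_ge (b : Bool) {i : ℕ} (hi : 22 ≤ i) : tmplPos b i = i := by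
  unfold tmplPos
  rw [List.getD_eq_default _ _ (by rw [length_zig]; omega)]

/-- The inverse table is the identity beyond the block. [folklore] -/
theorem tmplInv_of_ge (b : Bool) {r : ℕ} (hr : 22 ≤ r) : tmplInv b r = r := by
  unfold tmplInv; rw [if_neg (by omega)]

/-- The table stays in the block (kernel check). [folklore] -/
theorem tmplPos_lt (b : Bool) : ∀ i : Fin 22, tmplPos b i.val < 22 := by
  cases b <;> decide

/-- The inverse table stays in the block (kernel check). [folklore] -/
theorem tmplInv_lt (b : Bool) : ∀ r : Fin 22, tmplInv b r.val < 22 := by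
  cases b <;> decide

/-- `tmplInv` is a left inverse of `tmplPos` on the block (kernel check). [folklore] -/
theorem tmplInv_tmplPos_fin (b : Bool) : ∀ i : Fin 22, tmplInv b (tmplPos b i.val) = i.val := by
  cases b <;> decide

/-- `tmplPos` is a left inverse of `tmplInv` on the block (kernel check). [folklore] -/
theorem tmplPos_tmplInv_fin (b : Bool) : ∀ r : Fin 22, tmplPos b (tmplInv b r.val) = r.val := by
  cases b <;> decide

/-- `tmplInv ∘ tmplPos = id`. [folklore] -/
theorem tmplInv_tmplPos (b : Bool) (i : ℕ) : tmplInv b (tmplPos b i) = i := by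
  by_cases hi : i < 22
  · exact tmplInv_tmplPos_fin b ⟨i, hi⟩
  · rw [tmplPos_of_ge b (by omega), tmplInv_of_ge b (by omega)]

/-- `tmplPos ∘ tmplInv = id`. [folklore] -/
theorem tmplPos_tmplInv (b : Bool) (r : ℕ) : tmplPos b (tmplInv b r) = r := by
  by_cases hr : r < 22
  · exact tmplPos_tmplInv_fin b ⟨r, hr⟩
  · rw [tmplInv_of_ge b (by omega), tmplPos_of_ge b (by omega)]

/-- `tmplPos b` is injective. [folklore] -/
theorem tmplPos_injective (b : Bool) : Function.Injective (tmplPos b) :=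
  Function.LeftInverse.injective (tmplInv_tmplPos b)

/-- `tmplPos` preserves the block. [folklore] -/
theorem tmplPos_lt_iff (b : Bool) (i : ℕ) : tmplPos b i < 22 ↔ i < 22 := by
  constructor
  · intro h
    by_contra hi
    rw [tmplPos_of_ge b (by omega)] at h
    omega
  · intro h
    exact tmplPos_lt b ⟨i, h⟩

/-- The traversals start at the entry bead. [folklore] -/
theorem tmplPos_zero (b : Bool) : tmplPos b 0 = 0 := by cases b <;> rfl

/-- The traversals end at the exit bead. [folklore] -/
theorem tmplPos_last (b : Bool) : tmplPos b 21 = 21 := by cases b <;> rfl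

/-- The second vertex of a traversal is the top junction. [folklore] -/
theorem tmplPos_one (b : Bool) : tmplPos b 1 = 1 := by cases b <;> rfl

/-- Consecutive positions of a traversal are template edges (kernel check). [folklore] -/
theorem tmplAdjB_tmplPos_succ (b : Bool) : ∀ i : Fin 21, tmplAdjB (tmplPos b i.val) (tmplPos b (i.val + 1)) = true := by
  cases b <;> decide

/-- Template edges stay in the block (kernel check). [folklore] -/
theorem tmplRelB_lt : ∀ r s : Fin 34, tmplRelB r.val s.val = true → r.val < 22 ∧ s.val < 22 := by
  decide

/-- Template edges stay in the block. [folklore] -/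
theorem tmplRelB_bound {r s : ℕ} (h : tmplRelB r s = true) : r < 22 ∧ s < 22 := by
  have h' : r < 34 ∧ s < 34 := by
    unfold tmplRelB at h
    simp only [Bool.or_eq_true, Bool.and_eq_true, beq_iff_eq, decide_eq_true_eq] at h
    omega
  exact tmplRelB_lt ⟨r, h'.1⟩ ⟨s, h'.2⟩ h

/-- **The enumeration of one rod**: the Hamiltonian paths of the offsets `1, …, 21` (a block
without its entry bead) from the top junction `1` to the exit bead `21` along the template are
exactly the two zigzags without their first entry (kernel computation by the verified enumerator).
[folklore] -/
theorem hamPathsList_block :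
    hamPathsList tmplAdjB (List.range' 1 21) 1 21 = [(zig true).tail, (zig false).tail] := by
  decide +kernel


/-- The block is listed by mapping the table over the positions. [folklore] -/
theorem map_tmplPos_range (b : Bool) : (List.range 22).map (tmplPos b) = zig b := by
  cases b <;> decide

/-- A traversal is its entry bead followed by its tail. [folklore] -/
theorem zig_eq_cons_tail (b : Bool) : zig b = 0 :: (zig b).tail := by
  cases b <;> rfl

/-- Shifting a traversal: the shifted entry bead followed by the shifted tail. [folklore] -/
theorem map_add_zig (b : Bool) (c : ℕ) : (zig b).map (c + ·) = c :: ((zig b).tail.map (c + ·)) := by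
  cases b <;> simp [zig]

/-- Nothing points to the entry bead inside the template. [folklore] -/
theorem tmplRelB_zero_right (r : ℕ) : tmplRelB r 0 = false := by
  rw [Bool.eq_false_iff]
  intro h
  unfold tmplRelB at h
  simp only [Bool.or_eq_true, Bool.and_eq_true, beq_iff_eq, decide_eq_true_eq] at h
  omega

/-- The entry bead points only to the top junction. [folklore] -/
theorem tmplRelB_zero_left {s : ℕ} (h : tmplRelB 0 s = true) : s = 1 := by
  unfold tmplRelB at h
  simp only [Bool.or_eq_true, Bool.and_eq_true, beq_iff_eq, decide_eq_true_eq] at h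
  omega

/-! ### The rod chain -/

/-- The directed edge table of the chain of `N` rods: template edges inside a block, and the exit
bead of a block to the entry bead of the next. [folklore] -/
def relB (N u v : ℕ) : Bool :=
  (v < 22 * N) && ((u / 22 == v / 22 && tmplRelB (u % 22) (v % 22)) || (u % 22 == 21 && v == u + 1))

/-- **The rod chain with `N` rods.** [folklore] -/
def graph (N : ℕ) : _root_.SimpleGraph ℕ :=
  _root_.SimpleGraph.fromRel fun u v => relB N u v = true

/-- Adjacency in the rod chain is decidable. [folklore] -/
instance (N : ℕ) : DecidableRel (graph N).Adj := fun a b =>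
  inferInstanceAs (Decidable (a ≠ b ∧ (relB N a b = true ∨ relB N b a = true)))

/-- The vertices of the rod chain: `0, …, 22N - 1`. [folklore] -/
def verts (N : ℕ) : Finset ℕ :=
  Finset.range (22 * N)

/-- Adjacency in the rod chain, unfolded. [folklore] -/
theorem graph_adj {N u v : ℕ} : (graph N).Adj u v ↔ u ≠ v ∧ (relB N u v = true ∨ relB N v u = true) :=
  _root_.SimpleGraph.fromRel_adj _ _ _

/-- The directed edge table, unfolded. [folklore] -/
theorem relB_iff {N u v : ℕ} : relB N u v = true ↔ v < 22 * N ∧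
    ((u / 22 = v / 22 ∧ tmplRelB (u % 22) (v % 22) = true) ∨ (u % 22 = 21 ∧ v = u + 1)) := by
  simp [relB]

/-- Both ends of a directed edge are vertices. [folklore] -/
theorem relB_lt {N u v : ℕ} (h : relB N u v = true) : u < 22 * N ∧ v < 22 * N := by
  rw [relB_iff] at h
  obtain ⟨hv, ⟨hd, -⟩ | ⟨-, rfl⟩⟩ := h
  · constructor <;> omega
  · constructor <;> omega

/-- Adjacent vertices are vertices. [folklore] -/
theorem graph_adj_lt {N u v : ℕ} (h : (graph N).Adj u v) : u < 22 * N ∧ v < 22 * N := by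
  rw [graph_adj] at h
  obtain ⟨-, h | h⟩ := h
  · exact relB_lt h
  · exact ⟨(relB_lt h).2, (relB_lt h).1⟩

/-- **Adjacency inside a block is template adjacency.** [folklore] -/
theorem graph_adj_block {N k r s : ℕ} (hk : k < N) (hr : r < 22) (hs : s < 22) :
    (graph N).Adj (22 * k + r) (22 * k + s) ↔ tmplAdjB r s = true := by
  have hd1 : (22 * k + r) / 22 = k := by omega
  have hd2 : (22 * k + s) / 22 = k := by omega
  have hm1 : (22 * k + r) % 22 = r := by omega
  have hm2 : (22 * k + s) % 22 = s := by omega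
  rw [graph_adj, relB_iff, relB_iff, hd1, hd2, hm1, hm2, tmplAdjB]
  simp only [Bool.and_eq_true, bne_iff_ne, ne_eq, Bool.or_eq_true]
  constructor
  · rintro ⟨hne, ⟨-, ⟨-, h⟩ | ⟨h1, h2⟩⟩ | ⟨-, ⟨-, h⟩ | ⟨h1, h2⟩⟩⟩
    · exact ⟨by omega, Or.inl h⟩
    · omega
    · exact ⟨by omega, Or.inr h⟩
    · omega
  · rintro ⟨hne, h | h⟩
    · exact ⟨by omega, Or.inl ⟨by omega, Or.inl ⟨trivial, h⟩⟩⟩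
    · exact ⟨by omega, Or.inr ⟨by omega, Or.inl ⟨trivial, h⟩⟩⟩

/-- The exit bead of block `k` is adjacent to the entry bead of block `k + 1`. [folklore] -/
theorem graph_adj_connector {N k : ℕ} (hk : k + 1 < N) : (graph N).Adj (22 * k + 21) (22 * (k + 1)) := by
  rw [graph_adj, relB_iff]
  refine ⟨by omega, Or.inl ⟨by omega, Or.inr ⟨by omega, by omega⟩⟩⟩

/-- The chain with more rods restricts to the chain on the first `22N` vertices. [folklore] -/
theorem graph_adj_mono {N N' u v : ℕ} (hN : N ≤ N') (hu : u < 22 * N) (hv : v < 22 * N) :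
    (graph N).Adj u v ↔ (graph N').Adj u v := by
  rw [graph_adj, graph_adj, relB_iff, relB_iff, relB_iff, relB_iff]
  have hu' : u < 22 * N' := by omega
  have hv' : v < 22 * N' := by omega
  constructor
  · rintro ⟨hne, h | h⟩
    · exact ⟨hne, Or.inl ⟨hv', h.2⟩⟩
    · exact ⟨hne, Or.inr ⟨hu', h.2⟩⟩
  · rintro ⟨hne, h | h⟩
    · exact ⟨hne, Or.inl ⟨hv, h.2⟩⟩
    · exact ⟨hne, Or.inr ⟨hu, h.2⟩⟩

/-- No edge jumps over an entry bead. [folklore] -/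
theorem not_adj_across {N k u v : ℕ} (hu : u < 22 * k) (hv : 22 * k < v) : ¬ (graph N).Adj u v := by
  intro h
  rw [graph_adj, relB_iff, relB_iff] at h
  obtain ⟨-, ⟨-, ⟨hd, -⟩ | ⟨-, h2⟩⟩ | ⟨-, ⟨hd, -⟩ | ⟨-, h2⟩⟩⟩ := h <;> omega

/-- The only neighbour of an entry bead on its left is the preceding exit bead. [folklore] -/
theorem eq_of_adj_bead_left {N k x : ℕ} (hx : x < 22 * k) (h : (graph N).Adj x (22 * k)) : x = 22 * k - 1 := by
  rw [graph_adj, relB_iff, relB_iff] at h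
  obtain ⟨-, ⟨-, ⟨hd, -⟩ | ⟨h1, h2⟩⟩ | ⟨-, ⟨hd, -⟩ | ⟨h1, h2⟩⟩⟩ := h <;> omega

/-- The only neighbour of an entry bead on its right is its top junction. [folklore] -/
theorem eq_of_adj_bead_right {N k y : ℕ} (hy : 22 * k < y) (h : (graph N).Adj (22 * k) y) : y = 22 * k + 1 := by
  rw [graph_adj, relB_iff, relB_iff] at h
  have hm : (22 * k) % 22 = 0 := by omega
  rw [hm] at h
  obtain ⟨-, ⟨-, ⟨hd, ht⟩ | ⟨h1, -⟩⟩ | ⟨-, ⟨hd, ht⟩ | ⟨-, h2⟩⟩⟩ := h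
  · have := tmplRelB_zero_left ht
    omega
  · omega
  · rw [tmplRelB_zero_right] at ht
    exact absurd ht Bool.false_ne_true
  · omega

/-! ### The canonical paths -/

/-- The position permutation of a state vector: block `k` is listed in the order of the traversal
`zig (σ k)`. [folklore] -/
def perm (σ : ℕ → Bool) (j : ℕ) : ℕ :=
  22 * (j / 22) + tmplPos (σ (j / 22)) (j % 22)

/-- The inverse position permutation. [folklore] -/
def permInv (σ : ℕ → Bool) (v : ℕ) : ℕ :=
  22 * (v / 22) + tmplInv (σ (v / 22)) (v % 22)

/-- **The path of the state vector `σ`**: rod `k` traversed as `zig (σ k)`. [folklore] -/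
def pathOf (N : ℕ) (σ : ℕ → Bool) : List ℕ :=
  (List.range (22 * N)).map (perm σ)

/-- The position permutation preserves the block. [folklore] -/
theorem perm_div (σ : ℕ → Bool) (j : ℕ) : perm σ j / 22 = j / 22 := by
  have h := (tmplPos_lt_iff (σ (j / 22)) (j % 22)).2 (Nat.mod_lt _ (by omega))
  unfold perm
  omega

/-- The offset of the image of a position. [folklore] -/
theorem perm_mod (σ : ℕ → Bool) (j : ℕ) : perm σ j % 22 = tmplPos (σ (j / 22)) (j % 22) := by
  have h := (tmplPos_lt_iff (σ (j / 22)) (j % 22)).2 (Nat.mod_lt _ (by omega))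
  unfold perm
  omega

/-- `permInv` is a right inverse of `perm`. [folklore] -/
theorem perm_permInv (σ : ℕ → Bool) (v : ℕ) : perm σ (permInv σ v) = v := by
  have h : tmplInv (σ (v / 22)) (v % 22) < 22 := tmplInv_lt (σ (v / 22)) ⟨v % 22, Nat.mod_lt _ (by omega)⟩
  have hd : permInv σ v / 22 = v / 22 := by unfold permInv; omega
  have hm : permInv σ v % 22 = tmplInv (σ (v / 22)) (v % 22) := by unfold permInv; omega
  unfold perm
  rw [hd, hm, tmplPos_tmplInv]
  omega

/-- The position permutation is injective. [folklore] -/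
theorem perm_injective (σ : ℕ → Bool) : Function.Injective (perm σ) := by
  intro j j' h
  have hd : j / 22 = j' / 22 := by rw [← perm_div σ j, ← perm_div σ j', h]
  have hm : tmplPos (σ (j / 22)) (j % 22) = tmplPos (σ (j / 22)) (j' % 22) := by
    have := perm_mod σ j
    rw [h, perm_mod, ← hd] at this
    exact this.symm
  have := tmplPos_injective _ hm
  omega

/-- The position permutation preserves the range `[0, 22N)`. [folklore] -/
theorem perm_lt_iff (σ : ℕ → Bool) (N j : ℕ) : perm σ j < 22 * N ↔ j < 22 * N := by
  have := perm_div σ j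
  constructor <;> intro h <;> omega

/-- The path of a state vector has `22N` entries. [folklore] -/
theorem length_pathOf (N : ℕ) (σ : ℕ → Bool) : (pathOf N σ).length = 22 * N := by
  simp [pathOf]

/-- The entries of the path of a state vector. [folklore] -/
theorem getElem_pathOf {N : ℕ} {σ : ℕ → Bool} {j : ℕ} (hj : j < (pathOf N σ).length) :
    (pathOf N σ)[j] = perm σ j := by
  simp [pathOf]

/-- The path of a state vector visits exactly `0, …, 22N - 1`. [folklore] -/
theorem mem_pathOf_iff {N : ℕ} {σ : ℕ → Bool} {v : ℕ} : v ∈ pathOf N σ ↔ v < 22 * N := by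
  simp only [pathOf, List.mem_map, List.mem_range]
  constructor
  · rintro ⟨j, hj, rfl⟩
    exact (perm_lt_iff σ N j).2 hj
  · intro hv
    refine ⟨permInv σ v, ?_, perm_permInv σ v⟩
    rw [← perm_lt_iff σ N, perm_permInv]
    exact hv

/-- The path of a state vector has distinct entries. [folklore] -/
theorem nodup_pathOf (N : ℕ) (σ : ℕ → Bool) : (pathOf N σ).Nodup :=
  (List.nodup_range).map (perm_injective σ)

/-- Consecutive positions are sent to adjacent vertices. [folklore] -/
theorem graph_adj_perm_succ (σ : ℕ → Bool) {N j : ℕ} (hj : j + 1 < 22 * N) :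
    (graph N).Adj (perm σ j) (perm σ (j + 1)) := by
  by_cases h21 : j % 22 = 21
  · have e1 : perm σ j = 22 * (j / 22) + 21 := by
      unfold perm; rw [h21, tmplPos_last]
    have hd : (j + 1) / 22 = j / 22 + 1 := by omega
    have hm : (j + 1) % 22 = 0 := by omega
    have e2 : perm σ (j + 1) = 22 * (j / 22 + 1) := by
      unfold perm; rw [hd, hm, tmplPos_zero]; omega
    rw [e1, e2]
    exact graph_adj_connector (by omega)
  · have hd : (j + 1) / 22 = j / 22 := by omega
    have hm : (j + 1) % 22 = j % 22 + 1 := by omega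
    have hlt : j % 22 < 21 := by omega
    unfold perm
    rw [hd, hm]
    rw [graph_adj_block (by omega) ((tmplPos_lt_iff _ _).2 (by omega)) ((tmplPos_lt_iff _ _).2 (by omega))]
    exact tmplAdjB_tmplPos_succ (σ (j / 22)) ⟨j % 22, hlt⟩

/-- Consecutive entries of the path of a state vector are adjacent. [folklore] -/
theorem isChain_pathOf (N : ℕ) (σ : ℕ → Bool) : List.IsChain (graph N).Adj (pathOf N σ) := by
  unfold pathOf
  rw [List.isChain_map]
  cases h : 22 * N with
  | zero => simp
  | succ n =>
    rw [List.isChain_range_succ]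
    intro j hj
    exact graph_adj_perm_succ σ (by omega)

/-- **The path of every state vector is a Hamiltonian `s`–`t` path of the rod chain.** [folklore] -/
theorem isHamPathOn_pathOf {N : ℕ} (hN : 0 < N) (σ : ℕ → Bool) :
    IsHamPathOn (graph N) (verts N) 0 (22 * N - 1) (pathOf N σ) := by
  refine ⟨nodup_pathOf N σ, ?_, ?_, ?_, isChain_pathOf N σ⟩
  · ext v
    rw [List.mem_toFinset, mem_pathOf_iff, verts, Finset.mem_range]
  · rw [List.head?_eq_getElem?, List.getElem?_eq_getElem (by rw [length_pathOf]; omega), getElem_pathOf]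
    simp [perm, tmplPos_zero]
  · rw [List.getLast?_eq_getElem?, List.getElem?_eq_getElem (by rw [length_pathOf]; omega), getElem_pathOf,
      length_pathOf]
    unfold perm
    have hd : (22 * N - 1) / 22 = N - 1 := by omega
    have hm : (22 * N - 1) % 22 = 21 := by omega
    rw [hd, hm, tmplPos_last]
    congr 1
    omega

/-- The path depends only on the states of the rods. [folklore] -/
theorem pathOf_congr {N : ℕ} {τ τ' : ℕ → Bool} (h : ∀ i < N, τ i = τ' i) : pathOf N τ = pathOf N τ' := by
  unfold pathOf
  apply List.map_congr_left
  intro j hj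
  rw [List.mem_range] at hj
  unfold perm
  rw [h (j / 22) (by omega)]

/-- The path of `N + 1` rods: the path of `N` rods followed by the traversal of the last rod.
[folklore] -/
theorem pathOf_succ (N : ℕ) (τ : ℕ → Bool) :
    pathOf (N + 1) τ = pathOf N τ ++ (zig (τ N)).map (22 * N + ·) := by
  unfold pathOf
  rw [show 22 * (N + 1) = 22 * N + 22 by omega, List.range_add, List.map_append]
  congr 1
  rw [← map_tmplPos_range, List.map_map, List.map_map]
  apply List.map_congr_left
  intro i hi
  rw [List.mem_range] at hi
  have hd : (22 * N + i) / 22 = N := by omega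
  have hm : (22 * N + i) % 22 = i := by omega
  simp [perm, hd, hm]

/-! ### Relabelling the enumeration -/

section relabel

variable {α β : Type*} [DecidableEq α] [DecidableEq β]

omit [DecidableEq α] [DecidableEq β] in
/-- A list inside the image of `f` is the image of its pull-back. [folklore] -/
theorem map_map_eq_self_of_forall {f : α → β} {g : β → α} {l : List β}
    (h : ∀ x ∈ l, f (g x) = x) : (l.map g).map f = l := by
  rw [List.map_map]
  conv_rhs => rw [← List.map_id l]
  exact List.map_congr_left fun x hx => h x hx

/-- **Relabelling the enumeration**: along a map `f` with left inverse `g`, the enumeration of the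
relabelled problem lists exactly the images of the enumeration. [folklore] -/
theorem mem_hamPathsList_relabel {f : α → β} {g : β → α} (hgf : ∀ a, g (f a) = a)
    (adj : α → α → Bool) (vs : List α) (s t : α) (l : List β) :
    l ∈ hamPathsList (fun x y => adj (g x) (g y)) (vs.map f) (f s) (f t) ↔
      ∃ l₀ ∈ hamPathsList adj vs s t, l = l₀.map f := by
  have hf : Function.Injective f := Function.LeftInverse.injective hgf
  rw [mem_hamPathsList_iff]
  constructor
  · rintro ⟨hnd, hsub, hlen, hh, ht, hch⟩
    have hfg : ∀ x ∈ l, f (g x) = x := by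
      intro x hx
      obtain ⟨a, -, rfl⟩ := List.mem_map.1 (hsub x hx)
      rw [hgf]
    refine ⟨l.map g, (mem_hamPathsList_iff adj vs).2 ⟨?_, ?_, ?_, ?_, ?_, ?_⟩, (map_map_eq_self_of_forall hfg).symm⟩
    · exact hnd.map_on fun x hx y hy hxy => by rw [← hfg x hx, ← hfg y hy, hxy]
    · intro a ha
      obtain ⟨x, hx, rfl⟩ := List.mem_map.1 ha
      obtain ⟨a', ha', rfl⟩ := List.mem_map.1 (hsub x hx)
      rwa [hgf]
    · rw [List.length_map, hlen, List.length_map]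
    · rw [List.head?_map, hh]; simp [hgf]
    · rw [List.getLast?_map, ht]; simp [hgf]
    · exact List.isChain_map g |>.2 hch
  · rintro ⟨l₀, hl₀, rfl⟩
    obtain ⟨hnd, hsub, hlen, hh, ht, hch⟩ := (mem_hamPathsList_iff adj vs).1 hl₀
    refine ⟨hnd.map hf, fun x hx => ?_, by rw [List.length_map, hlen, List.length_map],
      by rw [List.head?_map, hh]; rfl, by rw [List.getLast?_map, ht]; rfl, ?_⟩
    · obtain ⟨a, ha, rfl⟩ := List.mem_map.1 hx
      exact List.mem_map.2 ⟨a, hsub a ha, rfl⟩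
    · rw [List.isChain_map]
      exact hch.imp fun a b h => by simpa [hgf] using h

end relabel

/-! ### Every Hamiltonian path of the rod chain is the path of a state vector -/

/-- The vertices of a block without its entry bead, as the list `22k+1, …, 22k+21`. [folklore] -/
theorem toFinset_blockList (k : ℕ) :
    ((List.range' 1 21).map (22 * k + ·)).toFinset = Finset.Ico (22 * k + 1) (22 * k + 22) := by
  ext v
  simp only [List.mem_toFinset, List.mem_map, List.mem_range'_1, Finset.mem_Ico]
  constructor
  · rintro ⟨r, hr, rfl⟩; omega
  · intro hv; exact ⟨v - 22 * k, by omega, by omega⟩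

/-- **The Hamiltonian paths of one block** of the chain from its top junction to its exit bead are
the two zigzags (without the entry bead). [folklore] -/
theorem block_cases {N k y : ℕ} (hk : k < N) {l : List ℕ}
    (h : IsHamPathOn (graph N) (Finset.Ico (22 * k + 1) (22 * k + 22)) y (22 * k + 21) l) (hy : y = 22 * k + 1) :
    l = (zig true).tail.map (22 * k + ·) ∨ l = (zig false).tail.map (22 * k + ·) := by
  subst hy
  set f : ℕ → ℕ := (22 * k + ·) with hf
  set g : ℕ → ℕ := (· - 22 * k) with hg
  have hgf : ∀ a, g (f a) = a := fun a => by simp [hf, hg]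
  rw [← toFinset_blockList k] at h
  have hvs : ((List.range' 1 21).map f).Nodup :=
    (List.nodup_range' : (List.range' 1 21).Nodup).map (Function.LeftInverse.injective hgf)
  have hadj : ∀ a ∈ (List.range' 1 21).map f, ∀ b ∈ (List.range' 1 21).map f,
      (graph N).Adj a b ↔ (fun x y => tmplAdjB (g x) (g y)) a b = true := by
    intro a ha b hb
    obtain ⟨r, hr, rfl⟩ := List.mem_map.1 ha
    obtain ⟨s, hs, rfl⟩ := List.mem_map.1 hb
    rw [List.mem_range'_1] at hr hs
    simp only [hgf]
    exact graph_adj_block hk (by omega) (by omega)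
  have hmem := (isHamPathOn_iff_mem_hamPathsList (graph N) (fun x y => tmplAdjB (g x) (g y)) _ hvs hadj).1 h
  rw [show (22 * k + 1 : ℕ) = f 1 from rfl, show (22 * k + 21 : ℕ) = f 21 from rfl,
    mem_hamPathsList_relabel hgf, hamPathsList_block] at hmem
  obtain ⟨l₀, hl₀, rfl⟩ := hmem
  simp only [List.mem_cons, List.not_mem_nil, or_false] at hl₀
  rcases hl₀ with rfl | rfl
  · exact Or.inl rfl
  · exact Or.inr rfl

/-- **Every Hamiltonian `s`–`t` path of the rod chain is the path of a state vector.** [folklore] -/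
theorem exists_eq_pathOf : ∀ {N : ℕ} (_ : 0 < N) {l : List ℕ},
    IsHamPathOn (graph N) (verts N) 0 (22 * N - 1) l → ∃ σ : Fin N → Bool, l = pathOf N (extB σ)
  | 0, hN, _, _ => absurd hN (lt_irrefl 0)
  | 1, _, l, h => by
    obtain ⟨hnd, hV, hhead, hlast, hchain⟩ := h
    obtain ⟨u, l₂, rfl⟩ : ∃ u l₂, l = u :: l₂ := by
      cases l with
      | nil => simp at hhead
      | cons u l₂ => exact ⟨u, l₂, rfl⟩
    simp only [List.head?_cons, Option.some.injEq] at hhead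
    subst hhead
    have h2 : l₂ ≠ [] := by rintro rfl; simp at hlast
    obtain ⟨y, r, rfl⟩ := List.exists_cons_of_ne_nil h2
    have hy : y = 22 * 0 + 1 := by
      have := eq_of_adj_bead_right (k := 0) (N := 1) (y := y) (by
        have hy0 : y ≠ 0 := by
          rintro rfl
          exact (List.nodup_cons.1 hnd).1 List.mem_cons_self
        omega) (by simpa using (List.isChain_cons_cons.1 hchain).1)
      simpa using this
    have hl₂ : IsHamPathOn (graph 1) (Finset.Ico (22 * 0 + 1) (22 * 0 + 22)) y (22 * 0 + 21) (y :: r) := by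
      refine ⟨(List.nodup_cons.1 hnd).2, ?_, rfl, by simpa using hlast, (List.isChain_cons_cons.1 hchain).2⟩
      ext v
      have hv : v ∈ (0 :: y :: r).toFinset ↔ v ∈ verts 1 := by rw [hV]
      simp only [List.toFinset_cons, Finset.mem_insert, List.mem_toFinset, verts, Finset.mem_range] at hv
      simp only [List.toFinset_cons, Finset.mem_insert, List.mem_toFinset, Finset.mem_Ico]
      have h0 : (0 : ℕ) ∉ y :: r := (List.nodup_cons.1 hnd).1
      constructor
      · intro hmem
        have : v ≠ 0 := by rintro rfl; exact h0 (by simpa using hmem)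
        have := hv.1 (Or.inr hmem)
        omega
      · intro hmem
        rcases hv.2 (by omega) with rfl | hmem'
        · omega
        · exact hmem'
    have key : ∀ b : Bool, pathOf 1 (extB fun _ : Fin 1 => b) = (22 * 0) :: (zig b).tail.map (22 * 0 + ·) := by
      intro b
      rw [show (1 : ℕ) = 0 + 1 from rfl, pathOf_succ]
      simp only [pathOf, Nat.mul_zero, List.range_zero, List.map_nil, List.nil_append]
      rw [show extB (fun _ : Fin 1 => b) 0 = b by simp [extB], map_add_zig]
    rcases block_cases (N := 1) (k := 0) Nat.one_pos hl₂ hy with hl | hl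
    · exact ⟨fun _ => true, by rw [key, hl]⟩
    · exact ⟨fun _ => false, by rw [key, hl]⟩
  | N + 2, _, l, h => by
    have hN : 0 < N + 1 := Nat.succ_pos N
    -- cut at the entry bead `22(N+1)` of the last rod
    have hsplit := h.split (A := Finset.range (22 * (N + 1))) (B := Finset.Ico (22 * (N + 1) + 1) (22 * (N + 1) + 22))
      (c := 22 * (N + 1)) (fun v => by simp only [verts, Finset.mem_range, Finset.mem_Ico]; omega)
      (by rw [Finset.disjoint_left]; intro v hv hv'; simp only [Finset.mem_range, Finset.mem_Ico] at hv hv'; omega)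
      (by simp) (by simp) (by simp) (by simp only [Finset.mem_Ico]; omega)
      (fun a ha b hb => by
        simp only [Finset.mem_range, Finset.mem_Ico] at ha hb
        exact not_adj_across (k := N + 1) ha (by omega))
    obtain ⟨l₁, l₂, x, y, rfl, h₁, h₂, hx, hy⟩ := hsplit
    -- the left piece is a Hamiltonian path of the shorter chain
    have hx' : x = 22 * (N + 1) - 1 :=
      eq_of_adj_bead_left (by simpa [Finset.mem_range] using h₁.end_mem) hx
    subst hx'
    have h₁' : IsHamPathOn (graph (N + 1)) (verts (N + 1)) 0 (22 * (N + 1) - 1) l₁ :=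
      h₁.mono fun a ha b hb hab => (graph_adj_mono (N' := N + 2) (by omega) (by simpa [Finset.mem_range] using ha)
        (by simpa [Finset.mem_range] using hb)).2 hab
    obtain ⟨σ', rfl⟩ := exists_eq_pathOf hN h₁'
    -- the right piece is one of the two traversals of the last rod
    have hy' : y = 22 * (N + 1) + 1 :=
      eq_of_adj_bead_right (by have := h₂.start_mem; simp only [Finset.mem_Ico] at this; omega) hy
    have h₂' : IsHamPathOn (graph (N + 2)) (Finset.Ico (22 * (N + 1) + 1) (22 * (N + 1) + 22)) y (22 * (N + 1) + 21) l₂ := by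
      have : 22 * (N + 2) - 1 = 22 * (N + 1) + 21 := by omega
      rwa [this] at h₂
    let b : Bool := decide (l₂ = (zig true).tail.map (22 * (N + 1) + ·))
    refine ⟨fun i => if h : i.val < N + 1 then σ' ⟨i.val, h⟩ else b, ?_⟩
    rw [show N + 2 = N + 1 + 1 from rfl, pathOf_succ (N + 1)]
    have hagree : pathOf (N + 1) (extB σ') =
        pathOf (N + 1) (extB fun i : Fin (N + 2) => if h : i.val < N + 1 then σ' ⟨i.val, h⟩ else b) :=
      pathOf_congr fun i hi => by simp [extB, hi, Nat.lt_succ_of_lt hi]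
    rw [← hagree]
    have hlast : extB (fun i : Fin (N + 2) => if h : i.val < N + 1 then σ' ⟨i.val, h⟩ else b) (N + 1) = b := by
      simp [extB]
    rw [hlast, map_add_zig]
    rcases block_cases (k := N + 1) (by omega) h₂' hy' with hl | hl
    · have hb : b = true := by simp [b, hl]
      rw [hb, hl]
    · have hb : b = false := by
        simp only [b, hl, decide_eq_false_iff_not]
        intro heq
        have h1 := congrArg (fun l : List ℕ => l[1]?) heq
        simp only [zig_true, zig_false, List.tail_cons, List.map_cons, List.getElem?_cons_succ,
          List.getElem?_cons_zero, Option.some.injEq] at h1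
        omega
      rw [hb, hl]

/-- **The Hamiltonian `s`–`t` paths of the rod chain are exactly the paths of the state vectors.**
[folklore] -/
theorem isHamPathOn_iff {N : ℕ} (hN : 0 < N) {l : List ℕ} :
    IsHamPathOn (graph N) (verts N) 0 (22 * N - 1) l ↔ ∃ σ : Fin N → Bool, l = pathOf N (extB σ) :=
  ⟨exists_eq_pathOf hN, by rintro ⟨σ, rfl⟩; exact isHamPathOn_pathOf hN _⟩

/-- Distinct state vectors give distinct paths. [folklore] -/
theorem pathOf_extB_injective (N : ℕ) : Function.Injective fun σ : Fin N → Bool => pathOf N (extB σ) := by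
  intro σ σ' h
  funext ⟨i, hi⟩
  have hlen : 22 * i + 2 < (pathOf N (extB σ)).length := by rw [length_pathOf]; omega
  have := congrArg (fun l : List ℕ => l[22 * i + 2]?) h
  simp only at this
  rw [List.getElem?_eq_getElem hlen, List.getElem?_eq_getElem (by rw [length_pathOf]; omega), getElem_pathOf,
    getElem_pathOf, Option.some.injEq] at this
  unfold perm at this
  have hm : (22 * i + 2) % 22 = 2 := by omega
  have hd : (22 * i + 2) / 22 = i := by omega
  simp only [hm, hd, extB, hi, ↓reduceDIte] at this
  cases h1 : σ ⟨i, hi⟩ <;> cases h2 : σ' ⟨i, hi⟩ <;> simp_all [tmplPos, zig]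

/-! ### Counting with required and forbidden edges -/

/-- **The constrained Hamiltonian-path counts of the rod chain are numbers of state vectors.**
[folklore] -/
theorem hamCountRF_eq_card {N : ℕ} (hN : 0 < N) (R F : Finset (ℕ × ℕ)) :
    hamCountRF (graph N) (verts N) 0 (22 * N - 1) R F =
      (Finset.univ.filter fun σ : Fin N → Bool =>
        (∀ e ∈ R, Uses (pathOf N (extB σ)) e) ∧ ∀ e ∈ F, ¬ Uses (pathOf N (extB σ)) e).card := by
  classical
  have hset : hamSetRF (graph N) (verts N) 0 (22 * N - 1) R F =
      (fun σ : Fin N → Bool => pathOf N (extB σ)) ''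
        ↑(Finset.univ.filter fun σ : Fin N → Bool =>
          (∀ e ∈ R, Uses (pathOf N (extB σ)) e) ∧ ∀ e ∈ F, ¬ Uses (pathOf N (extB σ)) e) := by
    ext l
    simp only [hamSetRF, Set.mem_setOf_eq, Set.mem_image, Finset.coe_filter, Finset.mem_univ, true_and]
    constructor
    · rintro ⟨hham, hR, hF⟩
      obtain ⟨σ, rfl⟩ := exists_eq_pathOf hN hham
      exact ⟨σ, ⟨hR, hF⟩, rfl⟩
    · rintro ⟨σ, ⟨hR, hF⟩, rfl⟩
      exact ⟨isHamPathOn_pathOf hN _, hR, hF⟩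
  rw [hamCountRF, hset, Set.ncard_image_of_injective _ (pathOf_extB_injective N), Set.ncard_coe_finset]

/-- **The Hamiltonian `s`–`t` paths of the rod chain number `2^N`.** [folklore] -/
theorem hamCount_rodChain {N : ℕ} (hN : 0 < N) : hamCount (graph N) (verts N) 0 (22 * N - 1) = 2 ^ N := by
  rw [Literature.Combinatorics.SimpleGraph.hamCount_eq, hamCountRF_eq_card hN]
  simp [Fintype.card_bool, Fintype.card_fin]

/-! ### Which edges of a rod the path of a state vector uses -/

/-- The table of used template edges, unfolded. [folklore] -/
theorem usesB_iff {b : Bool} {r s : ℕ} : usesB b r s = true ↔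
    ∃ i < 21, (tmplPos b i = r ∧ tmplPos b (i + 1) = s) ∨ (tmplPos b i = s ∧ tmplPos b (i + 1) = r) := by
  unfold usesB
  simp only [List.any_eq_true, List.mem_range, Bool.or_eq_true, Bool.and_eq_true, beq_iff_eq]

/-- **The edges of rod `k` used by the path of a state vector are read off the state `τ k`.**
[folklore] -/
theorem uses_pathOf_iff {N : ℕ} {τ : ℕ → Bool} {k r s : ℕ} (hk : k < N) (hr : r < 22) (hs : s < 22) :
    Uses (pathOf N τ) (22 * k + r, 22 * k + s) ↔ usesB (τ k) r s = true := by
  rw [uses_iff_exists_getElem, usesB_iff]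
  simp only [length_pathOf]
  constructor
  · rintro ⟨j, hj, h⟩
    rw [getElem_pathOf, getElem_pathOf] at h
    -- `j` lies in block `k`, not at its last position
    have hkey : ∀ {r s : ℕ}, r < 22 → s < 22 → perm τ j = 22 * k + r → perm τ (j + 1) = 22 * k + s →
        j / 22 = k ∧ j % 22 < 21 ∧ tmplPos (τ k) (j % 22) = r ∧ tmplPos (τ k) (j % 22 + 1) = s := by
      intro r s hr hs h1 h2
      have hd1 : j / 22 = k := by have := perm_div τ j; omega
      have hm1 : tmplPos (τ k) (j % 22) = r := by have := perm_mod τ j; rw [h1, hd1] at this; omega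
      have hne : j % 22 ≠ 21 := by
        intro h21
        have hd : (j + 1) / 22 = k + 1 := by omega
        have := perm_div τ (j + 1)
        omega
      have hd2 : (j + 1) / 22 = k := by omega
      have hm2 : tmplPos (τ k) (j % 22 + 1) = s := by
        have := perm_mod τ (j + 1)
        rw [h2, hd2, show (j + 1) % 22 = j % 22 + 1 by omega] at this; omega
      exact ⟨hd1, by omega, hm1, hm2⟩
    rcases h with ⟨h1, h2⟩ | ⟨h1, h2⟩
    · obtain ⟨-, hlt, e1, e2⟩ := hkey hr hs h1 h2
      exact ⟨j % 22, hlt, Or.inl ⟨e1, e2⟩⟩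
    · obtain ⟨-, hlt, e1, e2⟩ := hkey hs hr h1 h2
      exact ⟨j % 22, hlt, Or.inr ⟨e1, e2⟩⟩
  · rintro ⟨i, hi, h⟩
    have hd : (22 * k + i) / 22 = k := by omega
    have hm : (22 * k + i) % 22 = i := by omega
    have hd' : (22 * k + i + 1) / 22 = k := by omega
    have hm' : (22 * k + i + 1) % 22 = i + 1 := by omega
    have e1 : perm τ (22 * k + i) = 22 * k + tmplPos (τ k) i := by unfold perm; rw [hd, hm]
    have e2 : perm τ (22 * k + i + 1) = 22 * k + tmplPos (τ k) (i + 1) := by unfold perm; rw [hd', hm']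
    refine ⟨22 * k + i, by omega, ?_⟩
    rw [getElem_pathOf, getElem_pathOf, e1, e2]
    rcases h with ⟨h1, h2⟩ | ⟨h1, h2⟩
    · exact Or.inl ⟨by rw [h1], by rw [h2]⟩
    · exact Or.inr ⟨by rw [h1], by rw [h2]⟩

/-- Edges of the path never jump across blocks except at the connectors: an edge between different
blocks is an (exit bead, entry bead) pair. [folklore] -/
theorem uses_pathOf_across {N : ℕ} {τ : ℕ → Bool} {u v : ℕ} (h : Uses (pathOf N τ) (u, v))
    (huv : u / 22 ≠ v / 22) : (u % 22 = 21 ∧ v = u + 1) ∨ (v % 22 = 21 ∧ u = v + 1) := by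
  have hadj : (graph N).Adj u v := by
    by_cases hN : 0 < N
    · exact (isHamPathOn_pathOf hN τ).adj_of_uses h
    · have : N = 0 := by omega
      subst this
      have := h.mem.1
      simp [pathOf] at this
  rw [graph_adj, relB_iff, relB_iff] at hadj
  obtain ⟨-, ⟨-, ⟨hd, -⟩ | h⟩ | ⟨-, ⟨hd, -⟩ | h⟩⟩ := hadj
  · exact absurd hd huv
  · exact Or.inl h
  · exact absurd hd.symm huv
  · exact Or.inr h

/-- Sanity check (kernel): in the two traversals, the left exit slot `a₂–a₃` (offsets `4, 5`) and the
right entry slot `b₃–b₄` (offsets `11, 12`) are used exactly by `zig false`, the source slot `a₁–a₂`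
(offsets `3, 4`) and the top tie `Jt–a₀` (offsets `1, 2`) exactly by `zig true`, the bottom tie `a₄–a₅`
(offsets `6, 7`) exactly by `zig false`. [folklore] -/
theorem usesB_slots :
    (∀ b, usesB b 4 5 = !b) ∧ (∀ b, usesB b 11 12 = !b) ∧ (∀ b, usesB b 3 4 = b) ∧
      (∀ b, usesB b 1 2 = b) ∧ (∀ b, usesB b 6 7 = !b) := by
  refine ⟨?_, ?_, ?_, ?_, ?_⟩ <;> intro b <;> cases b <;> decide

end RodChain

end Literature.Combinatorics.SimpleGraph
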